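import Summits.ValiantsHypothesis.ValiantsHypothesis.Theorems.BarrierLeverAnchoredDoorHitsLowerPairsConjMReduction

/-!
# Support item `AnchoredDoorHitsLowerPairs` (stmt-ValiantsHypothesis-22510), line `anchored-peeling`:
# LT CERTIFICATES for Conjecture M (0/1 door supports with a unique perfect matching), and the CUBE-ROW sub-conjecture

Helper file (`--supports stmt-ValiantsHypothesis-22510`; cell valiant-natproofs, rung V4, 𝒟-side door (c); registered line
`Cruxes/AnchoredDoorHitsLowerPairs/Lines/anchored_peeling.lean` v16/v17, registered target `Stmt.stub_conjM` of `…ConjMReduction`; prover seat val-np-p1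
gen 21; memo HOME/val-np-p1/g21/MEMO-conjM-LT-valnp1-g21.md). Closes NO item.

THE EXACT ALGEBRA (§1–§2). Specialise only the SUPPORTS of the door elements: the column vertex `γ` gets a root set `B γ` and, for each root `b`, a tail set
`T γ b`; put `θ b γ = [b ∈ B γ]`, `φ b γ b' = [b' ∈ T γ b]` (`ltTheta`, `ltPhi`). Then every layout entry `[x^U] ∏_{γ∈W} D_γ` is a NATURAL NUMBER — the number
of decompositions of `U` into pairwise disjoint blocks `S γ = {b_γ} ∪ Z_γ` (`b_γ ∈ B γ`, `Z_γ ⊆ T γ b_γ`), one per vertex of the column (`DoorSupp`,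
`coeff_prod_doorElem_lt`). Consequently, if after permuting rows and columns the 0/1 support matrix is upper-triangular with nonzero diagonal (equivalently:
the support bipartite graph has a UNIQUE perfect matching), the door determinant is nonzero (`det_doorLayout_ne_zero_of_ltCert`): explicit `θ, φ ∈ {0,1}`
witness the instance of Conjecture M for that pair (`conjM_pair_of_ltCert`). This argument is characteristic-free.

THE CUBE-ROW SUB-CONJECTURE (§3). `Stmt.stub_ltCube`: every profile-dominated pair (cube rows `2^X`, lower columns) admits such a certificate (pure finite
combinatorics; SAT census memo §2: all 8 + 502 classes at `n = 3, 4`, 104/104 random and the complexes on 6 vertices at `n = 5`).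
`Stmt.stub_conjMcube`: Conjecture M restricted to cube rows. `conjMcube_of_ltCube`, `conjMcube_of_conjM`. NOTE (memo §3): the registered RELATIVE statement
`Stmt.stub_conjM` is true in characteristic 0 but FALSE in characteristic 2 for 7 of the 1 264 pairs at `n = 4` (stars against tail-truncating face rings), and
exactly those 7 pairs have no LT certificate — so LT certificates cannot prove `Stmt.stub_conjM` itself, only its cube-row case.

THE LOSSLESS MERGER (§4). Every known or conjectured member of the face-UQ residual has a full cube on one side (memo g20 §7). `Stmt.stub_uqFaceResidualRestCube`
(= the registered residual minus the pairs with a profile-dominating cube side), `stub_uqFaceResidual_of_conjMcube_rest`,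
`anchoredDoorHitsLowerPairs_of_conjMcube_rest` (route decl BY NAME), `stub_uqFaceResidualRestM_of_restCube`.

WHAT THIS IS NOT: `Stmt.stub_ltCube`, `Stmt.stub_conjMcube`, `Stmt.stub_conjM` are OPEN; nothing on crux stmt-ValiantsHypothesis-14610 or on `VP` versus `VNP`.
-/

set_option linter.dupNamespace false

namespace Summit.ValiantsHypothesis.ValiantsHypothesis.Theorems.BarrierLever.AnchoredPeeling

open Finset MvPolynomial
open Summit.ValiantsHypothesis.ValiantsHypothesis.Theorems.BarrierLever.BrickCalculus (pexpo pexpo_def pexpo_le_iff pexpo_sub)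

noncomputable section

variable {h : ℕ}

/-! ## 1. Support data, 0/1 doors, and the decomposition support of a column -/

/-- The 0/1 root weights of a support datum: `θ b γ = [b ∈ B γ]`. -/
def ltTheta (B : Fin h → Finset (Fin h)) : Fin h → Fin h → ℂ := fun b γ => if b ∈ B γ then 1 else 0

/-- The 0/1 tail weights of a support datum: `φ b γ b' = [b' ∈ T γ b]`. -/
def ltPhi (T : Fin h → Fin h → Finset (Fin h)) : Fin h → Fin h → Fin h → ℂ := fun b γ b' => if b' ∈ T γ b then 1 else 0

/-- `DoorSupp B T W U`: the row face `U` decomposes into pairwise disjoint blocks `S γ`, `γ ∈ W`, each consisting of a root `b ∈ B γ` of the column vertex `γ`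
together with a subset of that root's tail set `T γ b` — i.e. `x^U` occurs in the product of the 0/1 doors of the vertices of `W`. -/
def DoorSupp (B : Fin h → Finset (Fin h)) (T : Fin h → Fin h → Finset (Fin h)) (W U : Finset (Fin h)) : Prop :=
  ∃ S : Fin h → Finset (Fin h), (∀ γ ∈ W, ∃ b ∈ B γ, b ∈ S γ ∧ S γ ⊆ insert b (T γ b)) ∧
    (∀ γ ∈ W, ∀ γ' ∈ W, γ ≠ γ' → Disjoint (S γ) (S γ')) ∧ W.biUnion S = U

/-- The empty column supports exactly the empty row. -/
theorem doorSupp_empty (B : Fin h → Finset (Fin h)) (T : Fin h → Fin h → Finset (Fin h)) (U : Finset (Fin h)) :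
    DoorSupp B T ∅ U ↔ U = ∅ := by
  constructor
  · rintro ⟨S, -, -, hU⟩
    rw [Finset.biUnion_empty] at hU
    exact hU.symm
  · intro hU
    exact ⟨fun _ => ∅, fun γ hγ => absurd hγ (Finset.notMem_empty γ), fun γ hγ => absurd hγ (Finset.notMem_empty γ),
      by rw [Finset.biUnion_empty, hU]⟩

/-- Peeling one vertex off a column: `U ∈ Supp(γ ∪ W')` iff some block `{b} ∪ Z` of `γ` lies in `U` and the rest of `U` is in `Supp(W')`. -/
theorem doorSupp_insert (B : Fin h → Finset (Fin h)) (T : Fin h → Fin h → Finset (Fin h)) {γ : Fin h} {W' : Finset (Fin h)}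
    (hγ : γ ∉ W') (U : Finset (Fin h)) :
    DoorSupp B T (insert γ W') U ↔
      ∃ b ∈ B γ, ∃ Z ∈ (univ \ {b} : Finset (Fin h)).powerset, Z ⊆ T γ b ∧ insert b Z ⊆ U ∧ DoorSupp B T W' (U \ insert b Z) := by
  classical
  constructor
  · rintro ⟨S, hroot, hdisj, hU⟩
    obtain ⟨b, hbB, hbS, hST⟩ := hroot γ (Finset.mem_insert_self γ W')
    have hSγU : S γ ⊆ U := by
      rw [← hU]; exact Finset.subset_biUnion_of_mem S (Finset.mem_insert_self γ W')
    refine ⟨b, hbB, (S γ).erase b, ?_, ?_, ?_, ?_⟩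
    · rw [Finset.mem_powerset]
      intro x hx
      rw [Finset.mem_sdiff, Finset.mem_singleton]
      exact ⟨Finset.mem_univ x, (Finset.mem_erase.mp hx).1⟩
    · intro x hx
      obtain ⟨hxb, hxS⟩ := Finset.mem_erase.mp hx
      rcases Finset.mem_insert.mp (hST hxS) with hxb' | hxT
      · exact absurd hxb' hxb
      · exact hxT
    · rw [Finset.insert_erase hbS]; exact hSγU
    · refine ⟨S, fun γ' hγ' => hroot γ' (Finset.mem_insert_of_mem hγ'),
        fun γ₁ h₁ γ₂ h₂ hne => hdisj γ₁ (Finset.mem_insert_of_mem h₁) γ₂ (Finset.mem_insert_of_mem h₂) hne, ?_⟩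
      rw [Finset.insert_erase hbS]
      have hdis : Disjoint (S γ) (W'.biUnion S) := by
        rw [Finset.disjoint_biUnion_right]
        intro γ' hγ'
        exact hdisj γ (Finset.mem_insert_self γ W') γ' (Finset.mem_insert_of_mem hγ') (ne_of_mem_of_not_mem hγ' hγ).symm
      rw [← hU, Finset.biUnion_insert, Finset.union_sdiff_cancel_left hdis]
  · rintro ⟨b, hbB, Z, hZ, hZT, hbZU, S', hroot', hdisj', hU'⟩
    refine ⟨Function.update S' γ (insert b Z), ?_, ?_, ?_⟩
    · intro γ' hγ'
      rcases Finset.mem_insert.mp hγ' with rfl | hγ'W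
      · refine ⟨b, hbB, ?_, ?_⟩
        · rw [Function.update_self]; exact Finset.mem_insert_self b Z
        · rw [Function.update_self]; exact Finset.insert_subset_insert b hZT
      · rw [Function.update_of_ne (ne_of_mem_of_not_mem hγ'W hγ)]
        exact hroot' γ' hγ'W
    · intro γ₁ h₁ γ₂ h₂ hne
      have hsub : ∀ γ' ∈ W', S' γ' ⊆ U \ insert b Z := fun γ' hγ' => by
        rw [← hU']; exact Finset.subset_biUnion_of_mem S' hγ'
      rcases Finset.mem_insert.mp h₁ with rfl | h₁W <;> rcases Finset.mem_insert.mp h₂ with rfl | h₂W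
      · exact absurd rfl hne
      · rw [Function.update_self, Function.update_of_ne (ne_of_mem_of_not_mem h₂W hγ)]
        exact Finset.disjoint_of_subset_right (hsub γ₂ h₂W) Finset.disjoint_sdiff
      · rw [Function.update_self, Function.update_of_ne (ne_of_mem_of_not_mem h₁W hγ)]
        exact Finset.disjoint_of_subset_left (hsub γ₁ h₁W) Finset.sdiff_disjoint
      · rw [Function.update_of_ne (ne_of_mem_of_not_mem h₁W hγ), Function.update_of_ne (ne_of_mem_of_not_mem h₂W hγ)]
        exact hdisj' γ₁ h₁W γ₂ h₂W hne
    · rw [Finset.biUnion_insert, Function.update_self]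
      have hcongr : W'.biUnion (Function.update S' γ (insert b Z)) = W'.biUnion S' :=
        Finset.biUnion_congr rfl (fun γ' hγ' => by rw [Function.update_of_ne (ne_of_mem_of_not_mem hγ' hγ)])
      rw [hcongr, hU', Finset.union_sdiff_of_subset hbZU]

/-- `pexpo U ∅ = 0` iff `U = ∅`. -/
theorem pexpo_empty_right_eq_zero_iff (U : Finset (Fin h)) : pexpo U ∅ = 0 ↔ U = ∅ := by
  have h0 : pexpo (∅ : Finset (Fin h)) ∅ = 0 := by simp [pexpo_def]
  constructor
  · intro hU
    exact (DistinctAnchors.pexpo_inj (hU.trans h0.symm)).1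
  · rintro rfl; exact h0

/-! ## 2. Entries of the 0/1 door layout count decompositions; triangular support ⇒ nonzero determinant -/

/-- **Entries of the 0/1 door layout are natural numbers, nonzero exactly on the decomposition support.**
`[x^U] ∏_{γ∈W} D_γ = q ∈ ℕ` with `q ≠ 0 ↔ DoorSupp B T W U` (`q` is the number of decompositions). -/
theorem coeff_prod_doorElem_lt (B : Fin h → Finset (Fin h)) (T : Fin h → Fin h → Finset (Fin h)) (W : Finset (Fin h)) :
    ∀ U : Finset (Fin h), ∃ q : ℕ,
      coeff (pexpo U ∅) (∏ γ ∈ W, doorElem (ltTheta B) (ltPhi T) γ) = (q : ℂ) ∧ (q ≠ 0 ↔ DoorSupp B T W U) := by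
  classical
  induction W using Finset.induction_on with
  | empty =>
    intro U
    refine ⟨if U = ∅ then 1 else 0, ?_, ?_⟩
    · rw [Finset.prod_empty, MvPolynomial.coeff_one]
      by_cases hU : U = ∅
      · rw [if_pos ((pexpo_empty_right_eq_zero_iff U).mpr hU).symm, if_pos hU, Nat.cast_one]
      · rw [if_neg (fun h0 => hU ((pexpo_empty_right_eq_zero_iff U).mp h0.symm)), if_neg hU, Nat.cast_zero]
    · rw [doorSupp_empty]
      by_cases hU : U = ∅ <;> simp [hU]
  | insert γ W' hγ ih =>
    intro U
    choose q hq using ih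
    -- the natural number: sum over the blocks of γ
    refine ⟨∑ b : Fin h, ∑ Z ∈ (univ \ {b} : Finset (Fin h)).powerset,
        (if insert b Z ⊆ U ∧ b ∈ B γ ∧ Z ⊆ T γ b then q (U \ insert b Z) else 0), ?_, ?_⟩
    · rw [Finset.prod_insert hγ, doorElem, Finset.sum_mul, coeff_sum]
      push_cast
      refine Finset.sum_congr rfl (fun b _ => ?_)
      rw [coeff_cfacCore_mul]
      refine Finset.sum_congr rfl (fun Z _ => ?_)
      have hprod : (∏ d ∈ Z, ltPhi T b γ d) = if Z ⊆ T γ b then (1 : ℂ) else 0 := by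
        simp only [ltPhi]
        rw [Finset.prod_boole]
        rfl
      rw [hprod, (hq (U \ insert b Z)).1]
      simp only [ltTheta]
      by_cases h1 : insert b Z ⊆ U <;> by_cases h2 : b ∈ B γ <;> by_cases h3 : Z ⊆ T γ b <;> simp [h1, h2, h3]
    · rw [doorSupp_insert B T hγ U]
      constructor
      · intro hne
        obtain ⟨b, -, hb⟩ := Finset.exists_ne_zero_of_sum_ne_zero hne
        obtain ⟨Z, hZ, hbZ⟩ := Finset.exists_ne_zero_of_sum_ne_zero hb
        have hcond : insert b Z ⊆ U ∧ b ∈ B γ ∧ Z ⊆ T γ b := by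
          by_contra hc; exact hbZ (if_neg hc)
        rw [if_pos hcond] at hbZ
        exact ⟨b, hcond.2.1, Z, hZ, hcond.2.2, hcond.1, (hq _).2.mp hbZ⟩
      · rintro ⟨b, hbB, Z, hZ, hZT, hbZU, hsupp⟩
        have hterm : (if insert b Z ⊆ U ∧ b ∈ B γ ∧ Z ⊆ T γ b then q (U \ insert b Z) else 0) ≠ 0 := by
          rw [if_pos ⟨hbZU, hbB, hZT⟩]; exact (hq _).2.mpr hsupp
        intro hsum
        apply hterm
        have hb := (Finset.sum_eq_zero_iff.mp hsum) b (Finset.mem_univ b)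
        exact (Finset.sum_eq_zero_iff.mp hb) Z hZ

/-- **LT certificate ⇒ nonzero door determinant.** If, after permuting rows by `eR` and columns by `eC`, the 0/1 support matrix is upper-triangular
(`¬ DoorSupp` strictly below the diagonal) with full diagonal (`DoorSupp` on it), the layout of the 0/1 doors is nonsingular. -/
theorem det_doorLayout_ne_zero_of_ltCert {r : ℕ} (u w : Fin r → Finset (Fin h)) (B : Fin h → Finset (Fin h))
    (T : Fin h → Fin h → Finset (Fin h)) (eR eC : Equiv.Perm (Fin r))
    (hdiag : ∀ i, DoorSupp B T (w (eC i)) (u (eR i))) (htri : ∀ i j : Fin r, j < i → ¬ DoorSupp B T (w (eC j)) (u (eR i))) :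
    (Matrix.of fun i j : Fin r => coeff (pexpo (u i) ∅) (∏ γ ∈ w j, doorElem (ltTheta B) (ltPhi T) γ)).det ≠ 0 := by
  classical
  set M : Matrix (Fin r) (Fin r) ℂ :=
    Matrix.of fun i j : Fin r => coeff (pexpo (u i) ∅) (∏ γ ∈ w j, doorElem (ltTheta B) (ltPhi T) γ) with hM
  have hentry : ∀ i j, M i j = coeff (pexpo (u i) ∅) (∏ γ ∈ w j, doorElem (ltTheta B) (ltPhi T) γ) := fun i j => rfl
  -- the permuted matrix is upper-triangular with nonzero diagonal
  have hP : (M.submatrix eR eC).det ≠ 0 := by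
    have htriP : (M.submatrix (⇑eR) (⇑eC)).BlockTriangular id := by
      intro i j hij
      obtain ⟨q, hq, hiff⟩ := coeff_prod_doorElem_lt B T (w (eC j)) (u (eR i))
      rw [Matrix.submatrix_apply, hentry, hq]
      have hq0 : q = 0 := by
        by_contra hne; exact htri i j hij (hiff.mp hne)
      rw [hq0, Nat.cast_zero]
    rw [Matrix.det_of_upperTriangular htriP]
    refine Finset.prod_ne_zero_iff.mpr (fun i _ => ?_)
    obtain ⟨q, hq, hiff⟩ := coeff_prod_doorElem_lt B T (w (eC i)) (u (eR i))
    rw [Matrix.submatrix_apply, hentry, hq]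
    exact_mod_cast hiff.mpr (hdiag i)
  -- permutations do not change (non)vanishing of the determinant
  have hPM : (M.submatrix eR eC).det = Equiv.Perm.sign (eC.trans eR.symm) * M.det := by
    have hsub : M.submatrix (⇑eR) (⇑eC) = (M.submatrix eR eR).submatrix id (eC.trans eR.symm) := by
      ext i j
      simp only [Matrix.submatrix_apply, id, Equiv.trans_apply, Equiv.apply_symm_apply]
    rw [hsub, Matrix.det_permute', Matrix.det_submatrix_equiv_self]
  intro h0
  apply hP
  rw [hPM, h0, mul_zero]

/-- **An LT certificate of the pair `(u, w)`**: support data and row/column permutations making the 0/1 support matrix upper-triangular with full diagonal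
(equivalently: the support bipartite graph between columns and rows has a unique perfect matching). Pure finite combinatorics. -/
def LTCert {r : ℕ} (u w : Fin r → Finset (Fin h)) : Prop :=
  ∃ (B : Fin h → Finset (Fin h)) (T : Fin h → Fin h → Finset (Fin h)) (eR eC : Equiv.Perm (Fin r)),
    (∀ i, DoorSupp B T (w (eC i)) (u (eR i))) ∧ (∀ i j : Fin r, j < i → ¬ DoorSupp B T (w (eC j)) (u (eR i)))

/-- **LT certificate ⇒ the instance of Conjecture M for that pair** (explicit `θ, φ ∈ {0,1}`). -/
theorem conjM_pair_of_ltCert {r : ℕ} (u w : Fin r → Finset (Fin h)) (hc : LTCert u w) :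
    ∃ (θ : Fin h → Fin h → ℂ) (φ : Fin h → Fin h → Fin h → ℂ),
      (Matrix.of fun i j : Fin r => coeff (pexpo (u i) ∅) (∏ γ ∈ w j, doorElem θ φ γ)).det ≠ 0 := by
  obtain ⟨B, T, eR, eC, hdiag, htri⟩ := hc
  exact ⟨ltTheta B, ltPhi T, det_doorLayout_ne_zero_of_ltCert u w B T eR eC hdiag htri⟩

/-! ## 3. Cube rows: the combinatorial conjecture LT_cube and the sub-conjecture M_cube -/

/-- The rows form a full cube: `Set.range u = 2^X` for some vertex set `X`. -/
def IsCubeRows {r : ℕ} (u : Fin r → Finset (Fin h)) : Prop :=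
  ∃ X : Finset (Fin h), ∀ U : Finset (Fin h), U ∈ Set.range u ↔ U ⊆ X

/-- Cube rows form a lower family. -/
theorem isLowerSet_of_isCubeRows {r : ℕ} {u : Fin r → Finset (Fin h)} (hu : IsCubeRows u) : IsLowerSet (Set.range u) := by
  obtain ⟨X, hX⟩ := hu
  intro U V hVU hU
  exact (hX V).mpr (fun x hx => (hX U).mp hU (hVU hx))

/-- **CONJECTURE LT_cube (combinatorial; OFFERED stub text).** Every injective pair (cube rows `2^X`, lower columns of the same number) whose column profile is
dominated by the cube's admits an LT certificate. SAT census (memo §2): true for all classes at `|X| ≤ 4` and every tested pair at `|X| = 5`. UNPROVED. -/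
def Stmt.stub_ltCube : Prop :=
  ∀ (h r : ℕ) (u w : Fin r → Finset (Fin h)), Function.Injective u → Function.Injective w →
    IsCubeRows u → IsLowerSet (Set.range w) → ProfileDominated u w → LTCert u w

/-- **CONJECTURE M_cube (OFFERED stub text): Conjecture M for cube rows.** For every injective pair (cube rows `2^X`, lower columns) with dominated column profile
there are `θ, φ` with `det [ [x^U] D^W ] ≠ 0`. Weaker than `Stmt.stub_conjM`; in every tested instance it even has 0/1 triangular witnesses. UNPROVED. -/
def Stmt.stub_conjMcube : Prop :=
  ∀ (h r : ℕ) (u w : Fin r → Finset (Fin h)), Function.Injective u → Function.Injective w →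
    IsCubeRows u → IsLowerSet (Set.range w) → ProfileDominated u w →
    ∃ (θ : Fin h → Fin h → ℂ) (φ : Fin h → Fin h → Fin h → ℂ),
      (Matrix.of fun i j : Fin r => coeff (pexpo (u i) ∅) (∏ γ ∈ w j, doorElem θ φ γ)).det ≠ 0

/-- **LT_cube ⟹ M_cube** (the exact algebra of §2). -/
theorem conjMcube_of_ltCube (hLT : Stmt.stub_ltCube) : Stmt.stub_conjMcube :=
  fun h r u w hu hw hcube hlw hdom => conjM_pair_of_ltCert u w (hLT h r u w hu hw hcube hlw hdom)

/-- **M ⟹ M_cube** (cube rows are a lower family). -/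
theorem conjMcube_of_conjM (hM : Stmt.stub_conjM) : Stmt.stub_conjMcube :=
  fun h r u w hu hw hcube hlw hdom => hM h r u w hu hw (isLowerSet_of_isCubeRows hcube) hlw hdom

/-- **M_cube ⟹ every profile-dominated pair with cube rows is hit at profile 1** (the `ψ = 0` member, as in `symbolicDet_one_ne_zero_of_conjM`). -/
theorem symbolicDet_one_ne_zero_of_conjMcube (hM : Stmt.stub_conjMcube) {r : ℕ} (u w : Fin r → Finset (Fin h)) (hu : Function.Injective u)
    (hw : Function.Injective w) (hcube : IsCubeRows u) (hlw : IsLowerSet (Set.range w)) (hdom : ProfileDominated u w) :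
    symbolicDet 1 h r u w ≠ 0 := by
  classical
  obtain ⟨θ, φ, hdet⟩ := hM h r u w hu hw hcube hlw hdom
  intro h0
  have hmap := congrArg (eval (mPoint θ φ)) h0
  rw [map_zero, symbolicDet, RingHom.map_det] at hmap
  apply hdet
  rw [← hmap]
  congr 1
  refine Matrix.ext (fun i j => ?_)
  rw [RingHom.mapMatrix_apply, Matrix.map_apply, Matrix.of_apply, Matrix.of_apply, ← pexpo_def, ← coeff_map, map_mPoint_symbolicWitness,
    coeff_prod_cpart θ φ Finset.univ (u i) (w j) (Finset.subset_univ _)]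

/-! ## 4. The lossless merger with the cube rest -/

/-- **STUB TEXT (offered): THE FACE-UQ RESIDUAL MINUS THE PAIRS WITH A PROFILE-DOMINATING CUBE SIDE.** At some fixed profile `s ≥ 1` and all `h ≥ h₀`: every
injective simplicial-complex pair with `r ≥ 2` rows, NO face-UQ data on either side, and in which neither side is a full cube dominating the other side's profile,
has nonzero symbolic minor. (No known or conjectured member: memo g20 §7.) -/
def Stmt.stub_uqFaceResidualRestCube : Prop :=
  ∃ s h₀ : ℕ, 1 ≤ s ∧ ∀ h : ℕ, h₀ ≤ h → ∀ (r : ℕ) (u w : Fin r → Finset (Fin h)),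
    Function.Injective u → Function.Injective w → IsLowerSet (Set.range u) → IsLowerSet (Set.range w) → 2 ≤ r →
    (∀ (a : Fin h) (W₀ : Finset (Fin h)) (𝒜 : Finset (Finset (Fin h))) (ρ : Finset (Fin h) → Finset (Fin h)), ¬ UQFData s u w a W₀ 𝒜 ρ) →
    (∀ (c : Fin h) (Z : Finset (Fin h)) (𝒜 : Finset (Finset (Fin h))) (ρ : Finset (Fin h) → Finset (Fin h)), ¬ UQFData s w u c Z 𝒜 ρ) →
    ¬ (IsCubeRows u ∧ ProfileDominated u w) → ¬ (IsCubeRows w ∧ ProfileDominated w u) →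
    symbolicDet s h r u w ≠ 0

/-- **The lossless merger (kernel-checked): M_cube ∧ cube rest ⟹ the registered residual `Stmt.stub_uqFaceResidual`.** -/
theorem stub_uqFaceResidual_of_conjMcube_rest (hM : Stmt.stub_conjMcube) (hR : Stmt.stub_uqFaceResidualRestCube) :
    Stmt.stub_uqFaceResidual := by
  obtain ⟨s, h₀, hs, hR⟩ := hR
  refine ⟨s, h₀, hs, fun h hh r u w hu hw hlu hlw hr hx hy => ?_⟩
  by_cases hdx : IsCubeRows u ∧ ProfileDominated u w
  · exact symbolicDet_ne_zero_mono hs (symbolicDet_one_ne_zero_of_conjMcube hM u w hu hw hdx.1 hlw hdx.2)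
  · by_cases hdy : IsCubeRows w ∧ ProfileDominated w u
    · exact (symbolicDet_ne_zero_comm s h r u w).mpr
        (symbolicDet_ne_zero_mono hs (symbolicDet_one_ne_zero_of_conjMcube hM w u hw hu hdy.1 hlu hdy.2))
    · exact hR h hh r u w hu hw hlu hlw hr hx hy hdx hdy

/-- **Composition BY NAME: M_cube ∧ cube rest ⟹ the support item `AnchoredDoorHitsLowerPairs`.** -/
theorem anchoredDoorHitsLowerPairs_of_conjMcube_rest (hM : Stmt.stub_conjMcube) (hR : Stmt.stub_uqFaceResidualRestCube) :
    Summit.ValiantsHypothesis.ValiantsHypothesis.Theses.BarrierLever.AnchoredDoorHitsLowerPairs := by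
  obtain ⟨s, h₀, K⟩ := anchoredHit_of_uqFace stub_uqFaceStep (stub_uqFaceResidual_of_conjMcube_rest hM hR)
  exact ⟨s, h₀, fun h hh r u w hu hw hlu hlw => K h hh r u w hu hw hlu hlw⟩

/-- **LT_cube ∧ cube rest ⟹ the support item** (the combinatorial route, BY NAME). -/
theorem anchoredDoorHitsLowerPairs_of_ltCube_rest (hLT : Stmt.stub_ltCube) (hR : Stmt.stub_uqFaceResidualRestCube) :
    Summit.ValiantsHypothesis.ValiantsHypothesis.Theses.BarrierLever.AnchoredDoorHitsLowerPairs :=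
  anchoredDoorHitsLowerPairs_of_conjMcube_rest (conjMcube_of_ltCube hLT) hR

/-- The cube rest implies the crossing-profile rest of `…ConjMReduction` (its hypotheses are weaker). -/
theorem stub_uqFaceResidualRestM_of_restCube (hR : Stmt.stub_uqFaceResidualRestCube) : Stmt.stub_uqFaceResidualRestM := by
  obtain ⟨s, h₀, hs, hR⟩ := hR
  exact ⟨s, h₀, hs, fun h hh r u w hu hw hlu hlw hr hx hy hdx hdy =>
    hR h hh r u w hu hw hlu hlw hr hx hy (fun hc => hdx hc.2) (fun hc => hdy hc.2)⟩

end

end Summit.ValiantsHypothesis.ValiantsHypothesis.Theorems.BarrierLever.AnchoredPeeling
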